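import Mathlib
import HarnessLib
import Literature.MathematicalPhysics.QuantumLattice.HubbardBandSectorCountingBounds
import Literature.MathematicalPhysics.QuantumLattice.HubbardFermiRadiusBandSmooth

/-!
# Route `KLProgramme` — crux K1 `H10TwoPointLimit` (stmt-HubbardSuperconductivity-19938):
# the PERTURBED Fermi curve `{ε₀ + δ = μ}` of the Hubbard band as a radial graph — existence, level shift,
# closeness and uniqueness (BGM 2006 Lemma 2.1, the implicit-function step, order zero)

Benfatto–Giuliani–Mastropietro (Ann. Henri Poincaré 7 (2006) 809, §2.4 Lemma 2.1, (2.36)–(2.41)) replace the free dispersion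
`ε₀(k) = -2(cos k₁ + cos k₂)` at scale `h` by `E_h = ε₀ + δ_h` and use, for the sector geometry and the sector-propagator bounds,
that the interacting Fermi curve `{E_h = μ}` is again a centrally symmetric radial graph `k = u_h(θ)(cos θ, sin θ)` close to the
free one, with the free curve's transversality / convexity constants, UNIFORMLY in `h` — because `δ_h` is `C²`-small. In the
counterterm scheme of this programme (seat p2's `frameLevel μ K = ε₀ - μ - K`) the same object is the fixed curve `{ε₀ - K = μ}`.
The cell's gap ledger (gate-hubbard-kl, G-002, dispositions D-G-002-ref3 / D-G-002-dag) names this radial-graph lemma as the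
instantiation layer of the curve-generic sector counting («closer (ii): the implicit-function step of Lemma 2.1's proof»);
HOME/prover-p4/INVERSION-NOTE.md §2 Lemma I (i) is its paper form. This file proves it at ORDER ZERO over the tree's whole-band
polar toolbox (`HubbardFermiRadiusBand*`: `IsBandFermiRadius`, `bandFermiRadius`, `rayDispersion(Dt)`; `HubbardBandSectorCountingBounds`:
`BandBounds` with the radial transversality floor `Dt_min`), for an ARBITRARY perturbation `δ : (Fin 2 → ℝ) → ℝ` bounded by `κ₀` on
the closed square and a level window `[μ - κ₀, μ + κ₀] ⊂ [a, b] ⊂ (-4, 0)`: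

* VOCABULARY (no new definition): a perturbed Fermi point on the ray `θ`, i.e. `t ≥ 0`, `‖t·dir θ‖_∞ ≤ π`,
  `ε₀(t·dir θ) + δ(t·dir θ) = μ`, is LITERALLY the tree's `IsBandFermiRadius (μ - δ(t·dir θ)) θ t` — the free Fermi point of the
  SHIFTED LEVEL `μ - δ(t·dir θ) ∈ [μ - κ₀, μ + κ₀]` (`isBandFermiRadius_shifted_iff`); so every level-uniform field of `BandBounds`
  applies to the perturbed curve pointwise (`umin_le_of_shifted`, `Dtmin_le_rayDispersionDt_of_shifted`, open square);
* §1 the FREE radius as a function of the level: strictly increasing (`bandFermiRadius_lt_of_level_lt`) and `1/Dt_min`-Lipschitz on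
  `[a, b]` (`abs_bandFermiRadius_sub_le_of_level`, mean value theorem on `∂_μ u = 1/∂_t F`); the transversality floor
  `∂_t ε₀ ≥ Dt_min` at EVERY point of a ray whose level lies in `[a, b]` and the growth `C (t₂ - t₁) ≤ ε₀(t₂) - ε₀(t₁)`;
* §2 EXISTENCE on every ray for `δ` continuous (intermediate values: `E(0) ≤ -4 + κ₀ < μ < -κ₀ ≤ E(exit)`);
* §3 CLOSENESS `|t - u_μ(θ)| ≤ κ₀/Dt_min` (BGM (2.40), order zero) and the sandwich `u_{μ-κ₀}(θ) ≤ t ≤ u_{μ+κ₀}(θ)`;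
* §4 UNIQUENESS on the ray when `δ` is radially `κ₁`-Lipschitz on the segment with `κ₁ < Dt_min` (two roots `t₁ < t₂` would give
  `Dt_min (t₂ - t₁) ≤ ε₀(t₂) - ε₀(t₁) = δ(t₁) - δ(t₂) ≤ κ₁ (t₂ - t₁)`), and the radial Lipschitz bound from a gradient bound
  `‖Dδ‖ ≤ κ₁` on the closed square (sup norm; `‖dir θ‖_∞ ≤ 1`);
* §5 symmetry of the root SET: `θ + 2π` always, `θ + π` for even `δ`.
The NAMED radius `perturbedFermiRadius` and its angular regularity (implicit function theorem; BGM (2.40) first/second order) are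
companion files. Everything here is PROVED; no definitions, no named facts. References: BGM 2006 §2.4 Lemma 2.1 (2.36)–(2.41)
[cite: BenfattoGiulianiMastropietro2006]; BGM 2003 (AHP 4) p.5 (the lattice inversion problem); HOME/prover-p4/INVERSION-NOTE.md.
-/

noncomputable section
namespace Summit.HubbardSuperconductivity.HubbardSuperconductivity.Theorems.PerturbedFermiCurve

set_option linter.dupNamespace false -- summit = problem name (single-conjunct summit), D-0017

open Real Set Filter
open scoped Topology
open Literature.MathematicalPhysics.QuantumLattice Literature.MathematicalPhysics.QuantumLattice.BandSectorCounting

/-! ## §0 The ray segment inside the closed square; the shifted-level reading of a perturbed Fermi point -/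

/-- For `0 ≤ t` with `t‖dir θ‖_∞ ≤ π`, the point `t·dir θ` lies in the closed square `[-π, π]²`. [folklore] -/
theorem abs_smul_dir_apply_le_pi {θ t : ℝ} (ht : 0 ≤ t) (h : t * ‖dir θ‖ ≤ π) (i : Fin 2) :
    |(t • dir θ) i| ≤ π :=
  (abs_smul_dir_apply_le t θ i).trans (by rwa [norm_smul_dir ht])

/-- Membership in the monotonicity interval `[0, π/‖dir θ‖]` from the defining inequalities. [folklore] -/
theorem mem_Icc_exit_iff {θ t : ℝ} : t ∈ Icc 0 (π / ‖dir θ‖) ↔ 0 ≤ t ∧ t * ‖dir θ‖ ≤ π := by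
  rw [mem_Icc, le_div_iff₀ (norm_dir_pos θ)]

/-- **The shifted-level reading**: `t` is a Fermi point of the PERTURBED dispersion `ε₀ + δ` at level `μ` on the ray `θ`
(`t ≥ 0`, `‖t·dir θ‖_∞ ≤ π`, `ε₀(t·dir θ) + δ(t·dir θ) = μ`) iff it is a free Fermi point at the shifted level
`μ - δ(t·dir θ)`, i.e. `IsBandFermiRadius (μ - δ (t • dir θ)) θ t`. [cite: BenfattoGiulianiMastropietro2006, §2.4 Lemma 2.1] -/
theorem isBandFermiRadius_shifted_iff (δ : (Fin 2 → ℝ) → ℝ) (μ θ t : ℝ) :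
    IsBandFermiRadius (μ - δ (t • dir θ)) θ t ↔
      (0 ≤ t ∧ t * ‖dir θ‖ ≤ π) ∧ sqDispersion (t • dir θ) + δ (t • dir θ) = μ := by
  simp only [IsBandFermiRadius, rayDispersion]
  constructor
  all_goals rintro ⟨h1, h2⟩; exact ⟨h1, by linarith⟩

/-- The point of a (shifted-level) Fermi radius lies in the closed square. [folklore] -/
theorem abs_apply_le_pi_of_isBandFermiRadius {ν θ t : ℝ} (h : IsBandFermiRadius ν θ t) (i : Fin 2) :
    |(t • dir θ) i| ≤ π :=
  abs_smul_dir_apply_le_pi h.1.1 h.1.2 i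

/-- **The shifted level lies in the window**: if `|δ| ≤ κ₀` on the closed square then `μ - δ(t·dir θ) ∈ [μ - κ₀, μ + κ₀] ⊂ [a, b]`.
[folklore] -/
theorem shiftedLevel_mem_Icc {δ : (Fin 2 → ℝ) → ℝ} {κ₀ μ θ t a b : ℝ} (h : IsBandFermiRadius (μ - δ (t • dir θ)) θ t)
    (hδ : ∀ k : Fin 2 → ℝ, (∀ i, |k i| ≤ π) → |δ k| ≤ κ₀) (hlo : a ≤ μ - κ₀) (hhi : μ + κ₀ ≤ b) :
    μ - δ (t • dir θ) ∈ Icc a b := by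
  have hz := abs_le.1 (hδ _ (abs_apply_le_pi_of_isBandFermiRadius h))
  exact ⟨by linarith [hz.2], by linarith [hz.1]⟩

/-! ## §1 The FREE band Fermi radius as a function of the level: monotone and `1/Dt_min`-Lipschitz -/

/-- A point of the ray segment IS the band Fermi radius of its own level. [folklore] -/
theorem isBandFermiRadius_rayDispersion {θ s : ℝ} (hs0 : 0 ≤ s) (hs1 : s * ‖dir θ‖ ≤ π) :
    IsBandFermiRadius (rayDispersion (θ, s)) θ s := ⟨⟨hs0, hs1⟩, rfl⟩

/-- A point of the ray segment whose level lies in the band `(-4, 0)` equals the band Fermi radius of that level.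
[folklore] -/
theorem eq_bandFermiRadius_rayDispersion {θ s : ℝ} (hs0 : 0 ≤ s) (hs1 : s * ‖dir θ‖ ≤ π)
    (h1 : -4 < rayDispersion (θ, s)) (h2 : rayDispersion (θ, s) < 0) :
    s = bandFermiRadius (rayDispersion (θ, s)) θ :=
  bandFermiRadius_unique h1 h2 (isBandFermiRadius_rayDispersion hs0 hs1)

/-- **The band Fermi radius is strictly increasing in the level** (radial strict monotonicity of `ε₀`). [folklore] -/
theorem bandFermiRadius_lt_of_level_lt {μ ν : ℝ} (hμ : -4 < μ) (hμν : μ < ν) (hν : ν < 0) (θ : ℝ) :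
    bandFermiRadius μ θ < bandFermiRadius ν θ := by
  have hμ0 : μ < 0 := hμν.trans hν
  have hν4 : -4 < ν := hμ.trans hμν
  have h1 := isBandFermiRadius_bandFermiRadius hμ hμ0 θ
  have h2 := isBandFermiRadius_bandFermiRadius hν4 hν θ
  refine ((strictMonoOn_rayDispersion_band θ).lt_iff_lt h1.mem_Icc h2.mem_Icc).1 ?_
  show rayDispersion (θ, bandFermiRadius μ θ) < rayDispersion (θ, bandFermiRadius ν θ)
  rw [h1.2, h2.2]; exact hμν

/-- The band Fermi radius is monotone in the level. [folklore] -/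
theorem bandFermiRadius_le_of_level_le {μ ν : ℝ} (hμ : -4 < μ) (hμν : μ ≤ ν) (hν : ν < 0) (θ : ℝ) :
    bandFermiRadius μ θ ≤ bandFermiRadius ν θ := by
  rcases hμν.eq_or_lt with h | h
  · rw [h]
  · exact (bandFermiRadius_lt_of_level_lt hμ h hν θ).le

/-- **Growth of the free level function along a segment with a transversality floor**: if `C ≤ ∂_t ε₀(s·dir θ)` for all
`s ∈ [t₁, t₂]`, then `C (t₂ - t₁) ≤ ε₀(t₂·dir θ) - ε₀(t₁·dir θ)` (mean value theorem). [folklore] -/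
theorem mul_sub_le_rayDispersion_sub {θ t₁ t₂ C : ℝ} (h12 : t₁ ≤ t₂)
    (hC : ∀ s ∈ Icc t₁ t₂, C ≤ rayDispersionDt θ s) :
    C * (t₂ - t₁) ≤ rayDispersion (θ, t₂) - rayDispersion (θ, t₁) := by
  have hcont : ContinuousOn (fun t : ℝ => rayDispersion (θ, t)) (Icc t₁ t₂) :=
    ((contDiff_rayDispersion (n := 1)).continuous.comp (Continuous.prodMk_right θ)).continuousOn
  have hdiff : DifferentiableOn ℝ (fun t : ℝ => rayDispersion (θ, t)) (interior (Icc t₁ t₂)) :=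
    fun t _ => (hasDerivAt_rayDispersion_radius θ t).differentiableAt.differentiableWithinAt
  have hge : ∀ s ∈ interior (Icc t₁ t₂), C ≤ deriv (fun t : ℝ => rayDispersion (θ, t)) s := by
    intro s hs
    rw [interior_Icc] at hs
    rw [(hasDerivAt_rayDispersion_radius θ s).deriv]
    exact hC s ⟨hs.1.le, hs.2.le⟩
  exact (convex_Icc t₁ t₂).mul_sub_le_image_sub_of_le_deriv hcont hdiff hge t₁
    (left_mem_Icc.2 h12) t₂ (right_mem_Icc.2 h12) h12

section Band

variable {a b : ℝ} (B : BandBounds a b)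
include B

/-- **Radial transversality along the segment**: `∂_t ε₀(t·dir θ) ≥ Dt_min` at EVERY point of the ray segment whose level
lies in `[a, b]` (the `BandBounds` field `Dt_ge`, which is stated at the Fermi point of each level, read through
`eq_bandFermiRadius_rayDispersion`). [folklore] -/
theorem Dtmin_le_rayDispersionDt_of_level_mem {θ s : ℝ} (hs0 : 0 ≤ s) (hs1 : s * ‖dir θ‖ ≤ π)
    (hs : rayDispersion (θ, s) ∈ Icc a b) : B.Dtmin ≤ rayDispersionDt θ s := by
  have h4 : -4 < rayDispersion (θ, s) := B.ha.trans_le hs.1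
  have h0 : rayDispersion (θ, s) < 0 := hs.2.trans_lt B.hb
  have h := B.Dt_ge _ hs θ
  rwa [← eq_bandFermiRadius_rayDispersion hs0 hs1 h4 h0] at h

/-- **The band Fermi radius is `1/Dt_min`-Lipschitz in the level on `[a, b]`**: `|u_ν(θ) - u_μ(θ)| ≤ |ν - μ|/Dt_min`
(mean value theorem with `∂_μ u = 1/∂_t F ≤ 1/Dt_min`, `hasDerivAt_bandFermiRadius_level`). [folklore] -/
theorem abs_bandFermiRadius_sub_le_of_level {μ ν : ℝ} (hμ : μ ∈ Icc a b) (hν : ν ∈ Icc a b) (θ : ℝ) :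
    |bandFermiRadius ν θ - bandFermiRadius μ θ| ≤ |ν - μ| / B.Dtmin := by
  have hDt := B.Dtmin_pos
  have hderiv : ∀ x ∈ Icc a b, HasDerivWithinAt (fun ξ : ℝ => bandFermiRadius ξ θ)
      (1 / rayDispersionDt θ (bandFermiRadius x θ)) (Icc a b) x := fun x hx =>
    (hasDerivAt_bandFermiRadius_level (B.ha.trans_le hx.1) (hx.2.trans_lt B.hb) θ).hasDerivWithinAt
  have hbound : ∀ x ∈ Icc a b, ‖1 / rayDispersionDt θ (bandFermiRadius x θ)‖ ≤ 1 / B.Dtmin := by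
    intro x hx
    have hge := B.Dt_ge x hx θ
    have hpos : 0 < rayDispersionDt θ (bandFermiRadius x θ) := hDt.trans_le hge
    rw [Real.norm_eq_abs, abs_of_pos (one_div_pos.2 hpos)]
    exact one_div_le_one_div_of_le hDt hge
  have h := (convex_Icc a b).norm_image_sub_le_of_norm_hasDerivWithin_le hderiv hbound hμ hν
  rw [Real.norm_eq_abs, Real.norm_eq_abs] at h
  calc |bandFermiRadius ν θ - bandFermiRadius μ θ| ≤ 1 / B.Dtmin * |ν - μ| := h
    _ = |ν - μ| / B.Dtmin := by ring

/-- **Growth with the floor `Dt_min`**: if the levels at `t₁ ≤ t₂` on the ray both lie in `[a, b]`, then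
`Dt_min (t₂ - t₁) ≤ ε₀(t₂·dir θ) - ε₀(t₁·dir θ)`. [folklore] -/
theorem Dtmin_mul_sub_le_rayDispersion_sub {θ t₁ t₂ : ℝ} (h0 : 0 ≤ t₁) (h12 : t₁ ≤ t₂) (h2 : t₂ * ‖dir θ‖ ≤ π)
    (ha : a ≤ rayDispersion (θ, t₁)) (hb : rayDispersion (θ, t₂) ≤ b) :
    B.Dtmin * (t₂ - t₁) ≤ rayDispersion (θ, t₂) - rayDispersion (θ, t₁) := by
  have hn := norm_dir_pos θ
  have hmono := strictMonoOn_rayDispersion_band θ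
  have ht₁I : t₁ ∈ Icc 0 (π / ‖dir θ‖) :=
    ⟨h0, by rw [le_div_iff₀ hn]; exact (mul_le_mul_of_nonneg_right h12 hn.le).trans h2⟩
  have ht₂I : t₂ ∈ Icc 0 (π / ‖dir θ‖) := ⟨h0.trans h12, by rwa [le_div_iff₀ hn]⟩
  refine mul_sub_le_rayDispersion_sub h12 fun s hs => ?_
  have hs0 : 0 ≤ s := h0.trans hs.1
  have hsI : s ∈ Icc 0 (π / ‖dir θ‖) := ⟨hs0, hs.2.trans ht₂I.2⟩
  have hs1 : s * ‖dir θ‖ ≤ π := by rw [← le_div_iff₀ hn]; exact hsI.2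
  refine Dtmin_le_rayDispersionDt_of_level_mem B hs0 hs1 ⟨?_, ?_⟩
  · exact ha.trans (hmono.monotoneOn ht₁I hsI hs.1)
  · exact (hmono.monotoneOn hsI ht₂I hs.2).trans hb

end Band

/-! ## §2 Existence of a perturbed Fermi point on every ray -/

/-- The ray restriction `t ↦ ε₀(t·dir θ) + δ(t·dir θ)` of a continuous perturbation is continuous. [folklore] -/
theorem continuous_rayDispersion_add {δ : (Fin 2 → ℝ) → ℝ} (hδ : Continuous δ) (θ : ℝ) :
    Continuous fun t : ℝ => rayDispersion (θ, t) + δ (t • dir θ) :=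
  ((contDiff_rayDispersion (n := 1)).continuous.comp (Continuous.prodMk_right θ)).add
    (hδ.comp (continuous_id.smul continuous_const))

/-- **Existence** (BGM 2006 Lemma 2.1, the intermediate-value step): if `δ` is continuous with `|δ| ≤ κ₀` on the closed
square and `-4 + κ₀ < μ < -κ₀`, every ray carries a Fermi point of `ε₀ + δ` at level `μ` strictly between the origin and the
exit point (`E(0) ≤ -4 + κ₀ < μ` and `E(exit) ≥ -κ₀ > μ`), i.e. a free Fermi point of the shifted level.
[cite: BenfattoGiulianiMastropietro2006, §2.4 Lemma 2.1] -/
theorem exists_isBandFermiRadius_shifted {δ : (Fin 2 → ℝ) → ℝ} (hδc : Continuous δ) {κ₀ : ℝ}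
    (hδ : ∀ k : Fin 2 → ℝ, (∀ i, |k i| ≤ π) → |δ k| ≤ κ₀) {μ : ℝ} (hμ1 : -4 + κ₀ < μ) (hμ2 : μ < -κ₀) (θ : ℝ) :
    ∃ t ∈ Ioo 0 (π / ‖dir θ‖), IsBandFermiRadius (μ - δ (t • dir θ)) θ t := by
  have hn := norm_dir_pos θ
  have hT : 0 < π / ‖dir θ‖ := div_pos Real.pi_pos hn
  have hexit : π / ‖dir θ‖ * ‖dir θ‖ ≤ π := (div_mul_cancel₀ π hn.ne').le
  -- value at the origin
  have h0 : rayDispersion (θ, 0) + δ ((0 : ℝ) • dir θ) < μ := by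
    rw [rayDispersion_eq]
    have hz : |δ ((0 : ℝ) • dir θ)| ≤ κ₀ := hδ _ (abs_smul_dir_apply_le_pi le_rfl (by simp [Real.pi_pos.le]))
    have := (abs_le.1 hz).2
    simp only [zero_mul, Real.cos_zero] at this ⊢
    linarith
  -- value at the exit point
  have h1 : μ < rayDispersion (θ, π / ‖dir θ‖) + δ ((π / ‖dir θ‖) • dir θ) := by
    have hz : |δ ((π / ‖dir θ‖) • dir θ)| ≤ κ₀ := hδ _ (abs_smul_dir_apply_le_pi hT.le hexit)
    have := (abs_le.1 hz).1
    linarith [rayDispersion_exit_nonneg θ]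
  obtain ⟨t, ht, hte⟩ : ∃ t ∈ Ioo 0 (π / ‖dir θ‖), rayDispersion (θ, t) + δ (t • dir θ) = μ :=
    intermediate_value_Ioo hT.le (continuous_rayDispersion_add hδc θ).continuousOn ⟨h0, h1⟩
  refine ⟨t, ht, ⟨ht.1.le, by rw [← le_div_iff₀ hn]; exact ht.2.le⟩, ?_⟩
  show rayDispersion (θ, t) = μ - δ (t • dir θ)
  linarith

/-- Existence, level-window form: `[μ - κ₀, μ + κ₀] ⊂ [a, b]` with `B : BandBounds a b`. [folklore] -/
theorem exists_isBandFermiRadius_shifted' {a b : ℝ} (B : BandBounds a b) {δ : (Fin 2 → ℝ) → ℝ} (hδc : Continuous δ)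
    {κ₀ : ℝ} (hδ : ∀ k : Fin 2 → ℝ, (∀ i, |k i| ≤ π) → |δ k| ≤ κ₀) {μ : ℝ} (hlo : a ≤ μ - κ₀) (hhi : μ + κ₀ ≤ b)
    (θ : ℝ) : ∃ t ∈ Ioo 0 (π / ‖dir θ‖), IsBandFermiRadius (μ - δ (t • dir θ)) θ t :=
  exists_isBandFermiRadius_shifted hδc hδ (by linarith [B.ha]) (by linarith [B.hb]) θ

/-! ## §3 Consequences of the level shift: the `BandBounds` fields at a perturbed Fermi point; closeness -/

section Shifted

variable {a b : ℝ} (B : BandBounds a b) {δ : (Fin 2 → ℝ) → ℝ} {κ₀ μ θ t : ℝ}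
  (hδ : ∀ k : Fin 2 → ℝ, (∀ i, |k i| ≤ π) → |δ k| ≤ κ₀) (hlo : a ≤ μ - κ₀) (hhi : μ + κ₀ ≤ b)
  (ht : IsBandFermiRadius (μ - δ (t • dir θ)) θ t)
include B hδ hlo hhi ht

/-- **Level-shift identity**: `t = u_{μ - δ(t·dir θ)}(θ)` — a perturbed Fermi point IS the free band Fermi radius at the
shifted level. [cite: BenfattoGiulianiMastropietro2006, §2.4 Lemma 2.1] -/
theorem eq_bandFermiRadius_of_shifted : t = bandFermiRadius (μ - δ (t • dir θ)) θ :=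
  have hm := shiftedLevel_mem_Icc ht hδ hlo hhi
  bandFermiRadius_unique (B.ha.trans_le hm.1) (hm.2.trans_lt B.hb) ht

/-- **Radius lower bound** at a perturbed Fermi point: `u_min ≤ t`. [folklore] -/
theorem umin_le_of_shifted : B.umin ≤ t := by
  rw [eq_bandFermiRadius_of_shifted B hδ hlo hhi ht]
  exact B.umin_le _ (shiftedLevel_mem_Icc ht hδ hlo hhi) θ

/-- `t < π/‖dir θ‖`: the perturbed curve lies strictly before the exit point. [folklore] -/
theorem lt_exit_of_shifted : t < π / ‖dir θ‖ := by
  have hm := shiftedLevel_mem_Icc ht hδ hlo hhi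
  rw [eq_bandFermiRadius_of_shifted B hδ hlo hhi ht]
  exact bandFermiRadius_lt_exit (B.ha.trans_le hm.1) (hm.2.trans_lt B.hb) θ

/-- A perturbed Fermi point lies strictly between the origin and the exit point: `t ∈ (0, π/‖dir θ‖)`. [folklore] -/
theorem mem_Ioo_of_shifted : t ∈ Ioo 0 (π / ‖dir θ‖) :=
  ⟨B.umin_pos.trans_le (umin_le_of_shifted B hδ hlo hhi ht), lt_exit_of_shifted B hδ hlo hhi ht⟩

/-- **The perturbed curve lies in the OPEN square**: coordinates in `(-π, π)`. [folklore] -/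
theorem abs_apply_lt_pi_of_shifted (i : Fin 2) : |(t • dir θ) i| < π := by
  refine (abs_smul_dir_apply_le t θ i).trans_lt ?_
  rw [norm_smul_dir ht.1.1, ← lt_div_iff₀ (norm_dir_pos θ)]
  exact lt_exit_of_shifted B hδ hlo hhi ht

/-- **Transversality at a perturbed Fermi point**: `∂_t ε₀ ≥ Dt_min` there. [folklore] -/
theorem Dtmin_le_rayDispersionDt_of_shifted : B.Dtmin ≤ rayDispersionDt θ t := by
  refine Dtmin_le_rayDispersionDt_of_level_mem B ht.1.1 ht.1.2 ?_
  rw [ht.2]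
  exact shiftedLevel_mem_Icc ht hδ hlo hhi

/-- **Closeness to the free curve (BGM 2006 (2.40), order zero)**: `|t - u_μ(θ)| ≤ κ₀/Dt_min`, uniformly in `θ`.
[cite: BenfattoGiulianiMastropietro2006, §2.4 Lemma 2.1 (2.40)] -/
theorem abs_sub_bandFermiRadius_le_of_shifted : |t - bandFermiRadius μ θ| ≤ κ₀ / B.Dtmin := by
  have hm := shiftedLevel_mem_Icc ht hδ hlo hhi
  have hκ₀ : 0 ≤ κ₀ := (abs_nonneg _).trans (hδ _ (abs_apply_le_pi_of_isBandFermiRadius ht))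
  have hμ : μ ∈ Icc a b := ⟨by linarith, by linarith⟩
  have h1 := abs_bandFermiRadius_sub_le_of_level B hμ hm θ
  rw [← eq_bandFermiRadius_of_shifted B hδ hlo hhi ht] at h1
  refine h1.trans (div_le_div_of_nonneg_right ?_ B.Dtmin_pos.le)
  rw [show μ - δ (t • dir θ) - μ = -δ (t • dir θ) by ring, abs_neg]
  exact hδ _ (abs_apply_le_pi_of_isBandFermiRadius ht)

/-- **Sandwich** by the free radii at the extreme shifted levels: `u_{μ-κ₀}(θ) ≤ t ≤ u_{μ+κ₀}(θ)`. [folklore] -/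
theorem bandFermiRadius_le_and_le_of_shifted :
    bandFermiRadius (μ - κ₀) θ ≤ t ∧ t ≤ bandFermiRadius (μ + κ₀) θ := by
  have hm := shiftedLevel_mem_Icc ht hδ hlo hhi
  have hz := abs_le.1 (hδ _ (abs_apply_le_pi_of_isBandFermiRadius ht))
  have ha4 : -4 < μ - κ₀ := B.ha.trans_le hlo
  have hb0 : μ + κ₀ < 0 := hhi.trans_lt B.hb
  constructor
  · rw [eq_bandFermiRadius_of_shifted B hδ hlo hhi ht]
    exact bandFermiRadius_le_of_level_le ha4 (by linarith [hz.2]) (hm.2.trans_lt B.hb) θ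
  · rw [eq_bandFermiRadius_of_shifted B hδ hlo hhi ht]
    exact bandFermiRadius_le_of_level_le (B.ha.trans_le hm.1) (by linarith [hz.1]) hb0 θ

end Shifted

/-! ## §4 Uniqueness under a radial Lipschitz bound `κ₁ < Dt_min` -/

/-- **Uniqueness of the perturbed Fermi point on a ray** (BGM 2006 Lemma 2.1, the strict-monotonicity step): if `|δ| ≤ κ₀` on
the square, `[μ - κ₀, μ + κ₀] ⊂ [a, b]`, and `δ` is radially `κ₁`-Lipschitz on the segment of the ray `θ` with `κ₁ < Dt_min`, two
Fermi points `t₁, t₂` of `ε₀ + δ` at level `μ` on that ray coincide: `t₁ < t₂` would give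
`Dt_min (t₂ - t₁) ≤ ε₀(t₂) - ε₀(t₁) = δ(t₁) - δ(t₂) ≤ κ₁ (t₂ - t₁)`. [cite: BenfattoGiulianiMastropietro2006, §2.4 Lemma 2.1] -/
theorem shifted_unique {a b : ℝ} (B : BandBounds a b) {δ : (Fin 2 → ℝ) → ℝ} {κ₀ κ₁ μ θ : ℝ}
    (hδ : ∀ k : Fin 2 → ℝ, (∀ i, |k i| ≤ π) → |δ k| ≤ κ₀) (hlo : a ≤ μ - κ₀) (hhi : μ + κ₀ ≤ b)
    (hL : ∀ s t : ℝ, s ∈ Icc 0 (π / ‖dir θ‖) → t ∈ Icc 0 (π / ‖dir θ‖) →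
      |δ (s • dir θ) - δ (t • dir θ)| ≤ κ₁ * |s - t|)
    (hκ₁ : κ₁ < B.Dtmin) {t₁ t₂ : ℝ} (h₁ : IsBandFermiRadius (μ - δ (t₁ • dir θ)) θ t₁)
    (h₂ : IsBandFermiRadius (μ - δ (t₂ • dir θ)) θ t₂) : t₁ = t₂ := by
  -- the symmetric core: no two roots `s < t`
  have key : ∀ {s t : ℝ}, IsBandFermiRadius (μ - δ (s • dir θ)) θ s → IsBandFermiRadius (μ - δ (t • dir θ)) θ t →
      ¬ s < t := by
    intro s t hs ht hst
    have hms := shiftedLevel_mem_Icc hs hδ hlo hhi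
    have hmt := shiftedLevel_mem_Icc ht hδ hlo hhi
    have hgrow := Dtmin_mul_sub_le_rayDispersion_sub B hs.1.1 hst.le ht.1.2
      (by rw [hs.2]; exact hms.1) (by rw [ht.2]; exact hmt.2)
    rw [hs.2, ht.2] at hgrow
    have hlip := hL s t hs.mem_Icc ht.mem_Icc
    rw [abs_of_neg (sub_neg.2 hst)] at hlip
    have hlip' := (abs_le.1 hlip).2
    have hpos : 0 < t - s := sub_pos.2 hst
    nlinarith
  rcases lt_trichotomy t₁ t₂ with h | h | h
  · exact absurd h (key h₁ h₂)
  · exact h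
  · exact absurd h (key h₂ h₁)

/-- **Existence and uniqueness together**: under the hypotheses of `exists_isBandFermiRadius_shifted'` and `shifted_unique`
there is EXACTLY ONE Fermi point of `ε₀ + δ` at level `μ` on the ray `θ`. [cite: BenfattoGiulianiMastropietro2006, §2.4 Lemma 2.1] -/
theorem existsUnique_isBandFermiRadius_shifted {a b : ℝ} (B : BandBounds a b) {δ : (Fin 2 → ℝ) → ℝ} (hδc : Continuous δ)
    {κ₀ κ₁ μ : ℝ} (hδ : ∀ k : Fin 2 → ℝ, (∀ i, |k i| ≤ π) → |δ k| ≤ κ₀) (hlo : a ≤ μ - κ₀) (hhi : μ + κ₀ ≤ b) (θ : ℝ)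
    (hL : ∀ s t : ℝ, s ∈ Icc 0 (π / ‖dir θ‖) → t ∈ Icc 0 (π / ‖dir θ‖) →
      |δ (s • dir θ) - δ (t • dir θ)| ≤ κ₁ * |s - t|)
    (hκ₁ : κ₁ < B.Dtmin) : ∃! t, IsBandFermiRadius (μ - δ (t • dir θ)) θ t := by
  obtain ⟨t, -, ht⟩ := exists_isBandFermiRadius_shifted' B hδc hδ hlo hhi θ
  exact ⟨t, ht, fun s hs => shifted_unique B hδ hlo hhi hL hκ₁ hs ht⟩

/-! ## §5 From a gradient bound to the radial Lipschitz hypothesis -/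

/-- The ray map `t ↦ t·dir θ` has derivative `dir θ`. [folklore] -/
theorem hasDerivAt_smul_dir (θ t : ℝ) : HasDerivAt (fun s : ℝ => s • dir θ) (dir θ) t := by
  simpa using (hasDerivAt_id t).smul_const (dir θ)

/-- **A gradient bound on the closed square gives the radial Lipschitz bound** (sup norm on `ℝ²`, `‖dir θ‖_∞ ≤ 1`): if `δ` is
differentiable at every point of the closed square with `‖Dδ‖ ≤ κ₁` there, then
`|δ(s·dir θ) - δ(t·dir θ)| ≤ κ₁ |s - t|` on every ray segment. [folklore] -/
theorem radialLipschitz_of_fderiv_le {δ : (Fin 2 → ℝ) → ℝ} {κ₁ : ℝ}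
    (hd : ∀ k : Fin 2 → ℝ, (∀ i, |k i| ≤ π) → DifferentiableAt ℝ δ k)
    (hκ : ∀ k : Fin 2 → ℝ, (∀ i, |k i| ≤ π) → ‖fderiv ℝ δ k‖ ≤ κ₁) (θ : ℝ) :
    ∀ s t : ℝ, s ∈ Icc 0 (π / ‖dir θ‖) → t ∈ Icc 0 (π / ‖dir θ‖) →
      |δ (s • dir θ) - δ (t • dir θ)| ≤ κ₁ * |s - t| := by
  intro s t hs ht
  set g : ℝ → ℝ := fun r => δ (r • dir θ) with hg
  have hsq : ∀ r ∈ Icc 0 (π / ‖dir θ‖), ∀ i, |(r • dir θ) i| ≤ π := fun r hr =>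
    abs_smul_dir_apply_le_pi hr.1 (mem_Icc_exit_iff.1 hr).2
  have hderiv : ∀ r ∈ Icc 0 (π / ‖dir θ‖),
      HasDerivWithinAt g (fderiv ℝ δ (r • dir θ) (dir θ)) (Icc 0 (π / ‖dir θ‖)) r := by
    intro r hr
    have h1 : HasFDerivAt δ (fderiv ℝ δ (r • dir θ)) (r • dir θ) := (hd _ (hsq r hr)).hasFDerivAt
    exact (h1.comp_hasDerivAt r (hasDerivAt_smul_dir θ r)).hasDerivWithinAt
  have hbound : ∀ r ∈ Icc 0 (π / ‖dir θ‖), ‖fderiv ℝ δ (r • dir θ) (dir θ)‖ ≤ κ₁ := by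
    intro r hr
    refine ((fderiv ℝ δ (r • dir θ)).le_opNorm _).trans ?_
    have h0 : 0 ≤ ‖fderiv ℝ δ (r • dir θ)‖ := norm_nonneg _
    calc ‖fderiv ℝ δ (r • dir θ)‖ * ‖dir θ‖ ≤ ‖fderiv ℝ δ (r • dir θ)‖ * 1 :=
          mul_le_mul_of_nonneg_left (norm_dir_le_one θ) h0
      _ ≤ κ₁ := by rw [mul_one]; exact hκ _ (hsq r hr)
  have h := (convex_Icc (0 : ℝ) (π / ‖dir θ‖)).norm_image_sub_le_of_norm_hasDerivWithin_le hderiv hbound ht hs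
  simpa only [hg, Real.norm_eq_abs] using h

/-! ## §6 Symmetries of the root set -/

/-- `dir (θ + π) = -dir θ`. [folklore] -/
theorem dir_add_pi (θ : ℝ) : dir (θ + π) = -dir θ := by
  ext i; fin_cases i <;> simp [dir, Real.cos_add_pi, Real.sin_add_pi]

/-- `dir (θ + 2π) = dir θ`. [folklore] -/
theorem dir_add_two_pi (θ : ℝ) : dir (θ + 2 * π) = dir θ := by
  ext i; fin_cases i <;> simp [dir, Real.cos_add_two_pi, Real.sin_add_two_pi]
/-- The free level function is `π`-periodic in the angle along rays: `ε₀(t·dir(θ + π)) = ε₀(t·dir θ)` (`ε₀` is even). [folklore] -/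
theorem rayDispersion_add_pi (θ t : ℝ) : rayDispersion (θ + π, t) = rayDispersion (θ, t) := by
  simp [rayDispersion_eq, Real.cos_add_pi, Real.sin_add_pi, Real.cos_neg]

/-- **Periodicity of the root set**: the Fermi points of `ε₀ + δ` on the rays `θ` and `θ + 2π` are the same. [folklore] -/
theorem isBandFermiRadius_shifted_add_two_pi (δ : (Fin 2 → ℝ) → ℝ) (μ θ t : ℝ) :
    IsBandFermiRadius (μ - δ (t • dir (θ + 2 * π))) (θ + 2 * π) t ↔ IsBandFermiRadius (μ - δ (t • dir θ)) θ t := by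
  simp only [IsBandFermiRadius, dir_add_two_pi, rayDispersion_eq, Real.cos_add_two_pi, Real.sin_add_two_pi]

/-- **Central symmetry of the root set for an even perturbation**: the Fermi points of `ε₀ + δ` on the rays `θ` and `θ + π`
are the same when `δ(-k) = δ(k)` (the perturbed curve is centrally symmetric, as BGM's `E_h` and every `C₄ᵥ` frame).
[cite: BenfattoGiulianiMastropietro2006, §2.4 Lemma 2.1] -/
theorem isBandFermiRadius_shifted_add_pi {δ : (Fin 2 → ℝ) → ℝ} (heven : ∀ k, δ (-k) = δ k) (μ θ t : ℝ) :
    IsBandFermiRadius (μ - δ (t • dir (θ + π))) (θ + π) t ↔ IsBandFermiRadius (μ - δ (t • dir θ)) θ t := by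
  simp only [IsBandFermiRadius, dir_add_pi, smul_neg, heven, rayDispersion_add_pi, norm_neg]

end Summit.HubbardSuperconductivity.HubbardSuperconductivity.Theorems.PerturbedFermiCurve

end
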